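import Summits.BirchSwinnertonDyer.BirchSwinnertonDyer.Theorems.GenusKolyvaginAtTwoOffCutResidualAtTwoRSocleSelectionRealVisibleArchimedean
import Summits.BirchSwinnertonDyer.BirchSwinnertonDyer.Theorems.GenusKolyvaginAtTwoGenusPrimitiveSupplyAtTwoArchimedeanKummerCard
import Literature.NumberTheory.EllipticCurves.TateModuleBaseChange
import Literature.NumberTheory.EllipticCurves.Kramer1981.ArchimedeanNormIndexProofs
import Literature.NumberTheory.EllipticCurves.NonEisensteinPrimeOfSurjective
import HarnessLib

/-!
# Route `GenusKolyvaginAtTwo`, K₄⁺ kernel `K4Pos` (stmt-BirchSwinnertonDyer-31469), LINE 33 «twin_bsd_road» STUB F4′ `(NPh_K)` —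
# THE REAL PLACE IS A WITNESS: for `Δ_E > 0` the level-2 Lawson–Wuthrich class `ξ ∈ H¹(ℚ, E[2])` is NEVER a Kummer class at `∞`

Width seat `bsd-line-gk2-p4` g32 (cell `bsd-f1-sign2`), WIDTH-5 attach on route `GenusKolyvaginAtTwo` rev 59; director rulings (642)(2)/(644)(b):
the one GK2 width seat on F4′ = `(NPh_K)` off the cut.  `--supports stmt-BirchSwinnertonDyer-31469 --as helper`.  THEOREMS ONLY (no definition,
no named fact, no `sorry`); standard axioms.  **BSD is NOT proved by this file; `K4Pos` is NOT proved; nothing is closed by it.**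

WHY.  On a `2`-split Heegner frame the engine hypothesis `(NPh)` («no non-zero class of `H¹(K, E[2^M])` dying on `Γ_{K(E[2^M])}` is locally
Kummer», LINE 18 / LINE 26 / LINE 33 F4′) is decided over `ℚ` (g31 `Lw2PhantomExclusion.nonPhantom_pow_iff_exists_finite_place_rat`): it holds
iff the unique non-zero class `ξ ∈ H¹(ℚ, E[2])` dying on `Γ_{ℚ(E[4])}` (Lawson–Wuthrich, g10) FAILS the Kummer condition at some FINITE prime.
This file supplies the archimedean half of a place-free proof for `Δ_E > 0`:
* §1 `exists_fourTorsion_apply_resGal_eq_smul_sub_of_mem_selmerLocalKer` — `F ≃+* ℝ` a `ℚ`-field, `Δ_E > 0`: a level-`2` class that is KUMMER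
  at `F` has, for every representing cocycle `φ`, **`φ(res g) = res g • R − R` on `Γ_F` for ONE `R ∈ E[4](ℚ̄)`** — the Kummer classes at a real
  place with `Δ > 0` are `δ_∞(E(ℝ)/2E(ℝ)) = {0, δ_∞(T_egg)}` (`[E(ℝ) : 2E(ℝ)] = 2`, Kramer; the egg `2`-torsion point is not halvable over `ℝ`;
  halve it in `E(ℂ)`): local `2`-descent `2a ∈ E(F) = εT₁ + 2S′`, Galois descent `E(F̄)^{Γ_F} = E(F)`, transport `E[4](ℚ̄) ≃ E(F̄)[4]`.
* §2 ★ `not_mem_selmerLocalKer_infinitePlace_of_forall_torsionFixing_four` — **`Δ_E > 0`, `ρ̄_{E,2}`, `ρ̄_{E,4}` onto: a NON-ZERO `x ∈ H¹(ℚ, E[2])`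
  dying on `Γ_{ℚ(E[4])}` is NOT in `selmerLocalKer ℚ_∞ 2`.**  Proof: represent `x` by a crossed homomorphism `f₂` vanishing on `Γ_{ℚ(E[4])}`;
  its push-out `f₄ : Γ_ℚ → E[4]` has non-zero class (a principal `f₄ = ∂y` forces `2y ∈ E[2]^{Γ_ℚ} = 0`, so `x = [∂y] = 0`); by §1 a Kummer
  `x` has `f₄(c) = c•R − R` at the complex conjugation `c`, contradicting g30's visibility `…RealVisibleFrame.apply_ne_smul_sub_of_split` (the
  level-`4` Lawson–Wuthrich cocycle is NOT principal on `⟨c⟩` when `c` splits `E[4] = ℤP ⊕ ℤQ`, `cP = P`, `cQ = −Q` — g30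
  `…RealVisibleSplit/Archimedean`: `Δ > 0`).  Cocycle picture: `ξ(c) = T₁ + T₂` while `(c − 1)E[4] = {0, T_egg}`.
The consumer (`…K4PosTwinBsdRoadNonPhantom`, this seat): with the K₄⁺ REAL clause (some `2`-Selmer class of `E` is non-trivial at `∞`) the tree's
`Sel₂^{rel ∞}(E) = Sel₂(E)` (LEAD, `…KFourPosCellShaStructure`) turns «`ξ` Kummer at every finite prime» into «`ξ` Kummer at `∞`», which §2 forbids —
so a finite witness prime exists for EVERY K₄⁺ cell curve and `(NPh_K)` holds at every `2`-split Heegner frame.  BSD is NOT proved by any of this.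

References: [LawsonWuthrich2016] T. Lawson, C. Wuthrich, *Vanishing of some Galois cohomology groups for elliptic curves*, Springer PROMS 188
(2016), Lemma 3, Thm. 1, §7.1; [Kramer1981] §2 Prop. 6 (p. 127); [SilvermanAEC2009] VIII.§1–2, X.1.4, X.§4; [GrossLMS1991] §6, §9;
[SerreGaloisCohomology1997] I.§2.2, I.§5.8, II.§6.1.
-/

set_option autoImplicit false
set_option linter.dupNamespace false -- `Summit.<P>.<Sub>` repeats `BirchSwinnertonDyer` (D-0017)

noncomputable section

open scoped Classical

namespace Summit.BirchSwinnertonDyer.BirchSwinnertonDyer.Theorems.GenusExact.Lw2PhantomExclusion.RealWitness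

open WeierstrassCurve Field NumberField Literature.NumberTheory.EllipticCurves Literature.NumberTheory.GaloisRepresentations
open Summit.BirchSwinnertonDyer.BirchSwinnertonDyer.Theorems.GenusExact.PlusDescent.SocleSelection.RealVisible

/-! ## §1 `Δ > 0`: a level-`2` Kummer class at a real place is principal on `E[4]` -/

section Local

variable (W : WeierstrassCurve ℚ) [W.IsElliptic] {F : Type} [Field F] [Algebra ℚ F]

/-- **`[E(F) : 2E(F)] = 2` for a `ℚ`-field `F ≃+* ℝ` and `Δ_E > 0`** (Kramer's `[E(ℝ) : 2E(ℝ)] = 2`, transported along `F ≃+* ℝ` as in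
`GenusKolyArch.index_range_zsmulAddGroupHom_two_completion_eq_two_of_isReal`). [cite: Kramer1981, §2 Prop. 6 (p. 127)] -/
theorem index_range_zsmulAddGroupHom_two_eq_two_of_ringEquiv (e : F ≃+* ℝ) (hΔ : 0 < W.Δ) :
    (zsmulAddGroupHom (2 : ℤ) : (W.baseChange F).toAffine.Point →+ _).range.index = 2 := by
  letI : Algebra ℚ ℝ := (e.toRingHom.comp (algebraMap ℚ F)).toAlgebra
  rw [GenusKolyArch.index_range_zsmulAddGroupHom_eq_of_ringEquiv W e 2]
  have hΔ' : 0 < (W.baseChange ℝ).Δ := by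
    have h : (W.baseChange ℝ).Δ = e (algebraMap ℚ F W.Δ) := by
      rw [WeierstrassCurve.baseChange, WeierstrassCurve.map_Δ]; rfl
    rw [h, eq_ratCast, map_ratCast, Rat.cast_pos]
    exact hΔ
  have hK := Literature.NumberTheory.EllipticCurves.Kramer1981.index_range_two_eq_two_of_Δ_pos (W.baseChange ℝ) hΔ'
  rw [show (2 : ℤ) = ((2 : ℕ) : ℤ) from rfl, zsmulAddGroupHom_natCast]
  exact hK

/-- **`E(F) = 2E(F) ∪ (T₁ + 2E(F))`** for `F ≃+* ℝ`, `Δ_E > 0`, `T₁` the egg `2`-torsion point (not halvable over `F`): index `2` and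
`T₁ ∉ 2E(F)`. [cite: Kramer1981, §2 Prop. 6 (p. 127)] [cite: SilvermanAEC2009, Prop. X.1.4] -/
theorem exists_eq_twoTorsion_add_two_smul (e : F ≃+* ℝ) (hΔ : 0 < W.Δ) (S : (W.baseChange F).toAffine.Point) :
    ∃ (T S' : (W.baseChange F).toAffine.Point), (2 : ℤ) • T = 0 ∧ S = T + (2 : ℤ) • S' := by
  obtain ⟨P₁, -, -, -, -, -, -, -, -, -, h2P₁, -, -, hP₁, -⟩ := exists_twoTorsion_baseChange_of_ringEquiv W e hΔ
  set H := (zsmulAddGroupHom (2 : ℤ) : (W.baseChange F).toAffine.Point →+ _).range with hH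
  have hmem : ∀ P : (W.baseChange F).toAffine.Point, P ∈ H ↔ ∃ R : (W.baseChange F).toAffine.Point, (2 : ℤ) • R = P :=
    fun P ↦ by rw [hH, AddMonoidHom.mem_range]; rfl
  have hP₁H : P₁ ∉ H := fun h ↦ by
    obtain ⟨R, hR⟩ := (hmem P₁).mp h
    exact hP₁ R hR
  obtain ⟨a₀, ha₀⟩ := AddSubgroup.index_eq_two_iff.mp (index_range_zsmulAddGroupHom_two_eq_two_of_ringEquiv W e hΔ)
  have hPa : P₁ + a₀ ∈ H := by
    rcases ha₀ P₁ with ⟨h, -⟩ | ⟨h, -⟩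
    · exact h
    · exact absurd h hP₁H
  rcases ha₀ S with ⟨hS, -⟩ | ⟨hS, -⟩
  · -- `S + a₀ ∈ 2E(F)`, so `S - P₁ ∈ 2E(F)`
    have hd : S - P₁ ∈ H := by
      have e1 : S - P₁ = (S + a₀) - (P₁ + a₀) := by abel
      rw [e1]
      exact H.sub_mem hS hPa
    obtain ⟨S', hS'⟩ := (hmem _).mp hd
    exact ⟨P₁, S', h2P₁, by rw [hS']; abel⟩
  · obtain ⟨S', hS'⟩ := (hmem _).mp hS
    exact ⟨0, S', by rw [smul_zero], by rw [hS', zero_add]⟩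

/-- **`Δ > 0`: every `2`-torsion point of `E(F̄)` is fixed by `Γ_F`** (`F ≃+* ℝ`; all of `E[2]` is real): transport of g30's
`smul_eq_self_of_two_smul_eq_zero` (for `E[2](ℚ̄)`) along `E[2](ℚ̄) ≃ E(F̄)[2]` (`torsionPointsMap_bijective`) and
`E(F̄) = (E ×_ℚ F)(F̄)` (`localPointsEquivBaseChange`). [cite: Kramer1981, §2 Prop. 6 (p. 127)] [cite: SilvermanAEC2009, Cor. III.6.4 (b)] -/
theorem smul_eq_self_of_two_smul_eq_zero_local [CharZero F] (e : F ≃+* ℝ) (hΔ : 0 < W.Δ) (g : absoluteGaloisGroup F)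
    (t : geomPoints (W.baseChange F)) (ht : (2 : ℤ) • t = 0) : g • t = t := by
  set θ := localPointsEquivBaseChange W F with hθ
  -- `u = θ⁻¹ t` is a `2`-torsion local point, hence the image of a `2`-torsion point of `E(ℚ̄)`
  have hu : θ.symm t ∈ AddSubgroup.torsionBy (localPoints W F) ((2 : ℕ) : ℤ) := by
    rw [AddSubgroup.torsionBy, Submodule.mem_toAddSubgroup, Submodule.mem_torsionBy_iff, Nat.cast_ofNat, ← map_zsmul, ht, map_zero]
  obtain ⟨T₀, hT₀⟩ := (torsionPointsMap_bijective W F (n := 2) two_ne_zero).2 ⟨θ.symm t, hu⟩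
  have hT₀' : pointsMap W F (T₀ : geomPoints W) = θ.symm t := by
    rw [← coe_torsionPointsMap, hT₀]
  have hfix : resGal (K := ℚ) F g • (T₀ : geomPoints W) = T₀ := by
    rw [resGal_eq_absGaloisRestrict]
    exact smul_eq_self_of_two_smul_eq_zero W e hΔ g _ ((mem_geomTorsion_iff W _ _).mp T₀.2)
  calc g • t = θ (g • θ.symm t) := by rw [localPointsEquivBaseChange_smul, AddEquiv.apply_symm_apply]
    _ = θ (pointsMap W F (resGal (K := ℚ) F g • (T₀ : geomPoints W))) := by rw [pointsMap_smul, hT₀']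
    _ = t := by rw [hfix, hT₀', AddEquiv.apply_symm_apply]

/-- ★ **A LEVEL-`2` KUMMER CLASS AT A REAL PLACE IS PRINCIPAL ON `E[4]`** (`Δ_E > 0`, `F ≃+* ℝ` a `ℚ`-field, e.g. `F = ℚ_∞`).  If the class of the
continuous crossed homomorphism `φ : Γ_ℚ → E[2](ℚ̄)` lies in `selmerLocalKer F 2` — its restriction to `Γ_F` dies in `H¹(F, E(F̄))`, i.e.
`φ(res g) = g a − a` for a local point `a ∈ E(F̄)` — then there is ONE `R ∈ E(ℚ̄)` with `4R = 0` and **`φ(res g) = res g • R − R` for all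
`g ∈ Γ_F`**.  Proof: `2a ∈ E(F̄)^{Γ_F} = E(F)` (Galois descent); `[E(F) : 2E(F)] = 2` with the egg `2`-torsion point `T₁` as the non-trivial
coset, so `2a = εT₁ + 2S′`; halving `T₁ = 2r` in `E(F̄)` gives `a = εr + S′ + t` with `2t = 0`, and `S′`, `t` are `Γ_F`-fixed (all of `E[2]`
is real), whence `g a − a = ε(g r − r)` with `4r = 0`; transport `r` to `E[4](ℚ̄)`.  (The Kummer classes at `∞` for `Δ > 0`: `{0, δ_∞(T_egg)}`.)
[cite: Kramer1981, §2 Prop. 6 (p. 127)] [cite: SilvermanAEC2009, VIII.§2 and X.§4] [cite: GrossLMS1991, §6] -/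
theorem exists_fourTorsion_apply_resGal_eq_smul_sub_of_mem_selmerLocalKer [CharZero F] (e : F ≃+* ℝ) (hΔ : 0 < W.Δ)
    (φ : contOneCocycles (discreteTopRep (absoluteGaloisGroup ℚ) (geomTorsion W (2 : ℤ))))
    (hφ : oneCocycleClass _ φ ∈ selmerLocalKer W F (2 : ℤ)) :
    ∃ R : geomPoints W, (4 : ℤ) • R = 0 ∧ ∀ g : absoluteGaloisGroup F,
      ((φ.1 (resGal (K := ℚ) F g) : geomTorsion W (2 : ℤ)) : geomPoints W) = resGal (K := ℚ) F g • R - R := by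
  rw [WeierstrassCurve.selmerLocalKer, oneCocycleClass_mem_resKer_iff] at hφ
  obtain ⟨a, ha⟩ := hφ
  set θ := localPointsEquivBaseChange W F with hθ
  set b : geomPoints (W.baseChange F) := θ a with hb
  -- the cocycle read in `(E ×_ℚ F)(F̄)`
  have hval : ∀ g : absoluteGaloisGroup F,
      θ (pointsMap W F ((φ.1 (resGal (K := ℚ) F g) : geomTorsion W (2 : ℤ)) : geomPoints W)) = g • b - b := by
    intro g
    have h := ha g
    simp only [AddMonoidHom.coe_comp, AddSubgroup.coe_subtype, Function.comp_apply] at h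
    rw [h, map_sub, hb, localPointsEquivBaseChange_smul]
  -- `2b` is `Γ_F`-fixed, hence `F`-rational
  have h2val : ∀ g : absoluteGaloisGroup F, (2 : ℤ) • (g • b - b) = 0 := by
    intro g
    rw [← hval g, ← map_zsmul, ← map_zsmul, (mem_geomTorsion_iff W _ _).mp (φ.1 _).2, map_zero, map_zero]
  have h2b : (2 : ℤ) • b ∈ MulAction.fixedPoints (absoluteGaloisGroup F) (geomPoints (W.baseChange F)) := by
    intro g
    have h := h2val g
    rw [smul_sub, sub_eq_zero] at h
    rw [smul_zsmul_geomPoints, h]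
  obtain ⟨S, hS⟩ := (mem_range_toGeomPoints_iff (W.baseChange F) _).mpr h2b
  -- local `2`-descent of `S = 2b`
  obtain ⟨T, S', h2T, hST⟩ := exists_eq_twoTorsion_add_two_smul W e hΔ S
  -- halve `T` in `E(F̄)`
  obtain ⟨r, hr⟩ := (W.baseChange F).zsmul_geomPoints_surjective_of_charZero (n := 2) two_ne_zero
    (toGeomPoints (W.baseChange F) T)
  simp only at hr
  have h4r : (4 : ℤ) • r = 0 := by
    rw [show (4 : ℤ) = 2 * 2 by norm_num, mul_zsmul, hr, ← map_zsmul, h2T, map_zero]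
  -- `t = b - r - S'` is `2`-torsion, hence fixed; so `g b - b = g r - r`
  have ht2 : (2 : ℤ) • (b - r - toGeomPoints (W.baseChange F) S') = 0 := by
    rw [zsmul_sub, zsmul_sub, hr, ← hS, hST, map_add, map_zsmul]
    abel
  have hgb : ∀ g : absoluteGaloisGroup F, g • b - b = g • r - r := by
    intro g
    have ht := smul_eq_self_of_two_smul_eq_zero_local W e hΔ g _ ht2
    rw [smul_sub, smul_sub, smul_toGeomPoints] at ht
    -- `g b - g r - S' = b - r - S'`
    have h' : g • b - g • r = b - r := sub_left_injective ht
    calc g • b - b = (g • b - g • r) + (g • r - b) := by abel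
      _ = (b - r) + (g • r - b) := by rw [h']
      _ = g • r - r := by abel
  -- transport `r` back to `E[4](ℚ̄)`
  have hru : θ.symm r ∈ AddSubgroup.torsionBy (localPoints W F) ((4 : ℕ) : ℤ) := by
    rw [AddSubgroup.torsionBy, Submodule.mem_toAddSubgroup, Submodule.mem_torsionBy_iff, Nat.cast_ofNat, ← map_zsmul, h4r, map_zero]
  obtain ⟨R₄, hR₄⟩ := (torsionPointsMap_bijective W F (n := 4) (by norm_num)).2 ⟨θ.symm r, hru⟩
  have hR₄' : pointsMap W F (R₄ : geomPoints W) = θ.symm r := by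
    rw [← coe_torsionPointsMap, hR₄]
  refine ⟨(R₄ : geomPoints W), ?_, fun g ↦ ?_⟩
  · exact (mem_geomTorsion_iff W _ _).mp R₄.2
  · apply pointsMapOfEmb_injective W (closureEmb (K := ℚ) F)
    apply θ.injective
    change θ (pointsMap W F _) = θ (pointsMap W F _)
    rw [hval g, hgb g, map_sub, pointsMap_smul, hR₄', map_sub, localPointsEquivBaseChange_smul, AddEquiv.apply_symm_apply]

end Local

/-! ## §2 ★ `Δ > 0`: the level-`2` Lawson–Wuthrich class is NOT a Kummer class at the real place -/

section Main

variable (W : WeierstrassCurve ℚ) [W.IsElliptic]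

/-- **`ρ̄_{E,2}` onto ⟹ no non-zero `Γ_ℚ`-fixed `2`-torsion point of `E(ℚ̄)`**: `E[2]` is irreducible
(`hasIrreducibleModPGaloisRep_of_hasSurjectiveModNGaloisRep`) and the line `{0, T}` through a fixed `T ≠ 0` would be a `Γ_ℚ`-stable
subgroup of `E[2]` (order `4`) that is neither `0` nor everything. [cite: SilvermanAEC2009, III.6.4 (b)] [cite: Serre1972, §4] -/
theorem eq_zero_of_two_smul_eq_zero_of_forall_smul_eq (hs2 : W.HasSurjectiveModNGaloisRep (2 : ℤ))
    (T : geomPoints W) (h2 : (2 : ℤ) • T = 0) (hfix : ∀ γ : absoluteGaloisGroup ℚ, γ • T = T) : T = 0 := by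
  haveI : Fact (Nat.Prime 2) := ⟨Nat.prime_two⟩
  haveI : NeZero ((2 : ℕ) : ℚ) := ⟨by norm_num⟩
  have hirr := hasIrreducibleModPGaloisRep_of_hasSurjectiveModNGaloisRep W 2 (by simpa using hs2)
  by_contra hT
  let T' : geomTorsion W ((2 : ℕ) : ℤ) := ⟨T, (mem_geomTorsion_iff W _ _).mpr (by simpa using h2)⟩
  have hT' : T' ≠ 0 := fun h ↦ hT (congrArg Subtype.val h)
  have hfix' : ∀ γ : absoluteGaloisGroup ℚ, γ • T' = T' := fun γ ↦ Subtype.ext (by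
    rw [AddSubgroup.torsionBy.coe_smul]; exact hfix γ)
  -- the line `{0, T}` is `Γ_ℚ`-stable, neither `⊥` nor all of `E[2]`
  have hstab : ∀ σ : absoluteGaloisGroup ℚ, ∀ P ∈ AddSubgroup.zmultiples T', σ • P ∈ AddSubgroup.zmultiples T' := by
    intro σ P hP
    obtain ⟨k, rfl⟩ := AddSubgroup.mem_zmultiples_iff.mp hP
    rw [smul_comm, hfix' σ]
    exact AddSubgroup.zsmul_mem _ (AddSubgroup.mem_zmultiples T') k
  rcases hirr (AddSubgroup.zmultiples T') hstab with hbot | htop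
  · exact hT' ((AddSubgroup.eq_bot_iff_forall _).mp hbot T' (AddSubgroup.mem_zmultiples T'))
  · have hcard4 : Nat.card (geomTorsion W ((2 : ℕ) : ℤ)) = 2 ^ 2 :=
      card_torsionPoints_eq_sq_holds W (AlgebraicClosure ℚ) (n := 2) (by norm_num)
    have hle : Nat.card (AddSubgroup.zmultiples T') ≤ 2 := by
      rw [Nat.card_zmultiples]
      refine Nat.le_of_dvd two_pos (addOrderOf_dvd_iff_nsmul_eq_zero.mpr (Subtype.ext ?_))
      rw [AddSubmonoidClass.coe_nsmul, ZeroMemClass.coe_zero, ← natCast_zsmul]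
      exact h2
    rw [htop, AddSubgroup.card_top, hcard4] at hle
    norm_num at hle

/-- ★ **THE REAL PLACE WITNESSES THE LAWSON–WUTHRICH CLASS (`Δ_E > 0`).**  `E/ℚ` elliptic with `Δ_E > 0` and `ρ̄_{E,2}`, `ρ̄_{E,4}` surjective;
`w` the real place of `ℚ`.  Then every NON-ZERO `x ∈ H¹(ℚ, E[2])` with `[x, ρ] = 0` for all `ρ ∈ Γ_{ℚ(E[4])}` (there is exactly one: the inflation of
the generator of `H¹(GL₂(ℤ/4), 𝔽₂²) = 𝔽₂`) is **NOT in `selmerLocalKer ℚ_w 2`**: its localisation at `∞` is not in the image `δ_∞(E(ℝ)/2E(ℝ))` of the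
local Kummer map.  (At the complex conjugation `c`: `ξ(c) = T₁ + T₂`, whereas the Kummer classes give `(c − 1)E[4] = {0, T_egg}`.)  Proof: represent
`x` by `f₂` vanishing on `Γ_{ℚ(E[4])}`; the push-out `f₄ : Γ_ℚ → E[4]` has non-zero class (`f₄ = ∂y` would force `2y ∈ E[2]^{Γ_ℚ} = 0` and `x = [∂y] = 0`);
were `x` Kummer at `w`, §1 would make `f₄(c) = c • R − R` for some `R ∈ E[4]`, against `…RealVisibleFrame.apply_ne_smul_sub_of_split` at the
`(1, −1)`-splitting of `E[4]` under `c` (`…RealVisibleSplit`, archimedean inputs of `…RealVisibleArchimedean`).  BSD is NOT proved by this.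
[cite: LawsonWuthrich2016, Lemma 3, Thm. 1, §7.1] [cite: Kramer1981, §2 Prop. 6 (p. 127)] [cite: SerreGaloisCohomology1997, I.§5.8, II.§6.1] -/
theorem not_mem_selmerLocalKer_infinitePlace_of_forall_torsionFixing_four (hΔ : 0 < W.Δ)
    (hs2 : W.HasSurjectiveModNGaloisRep (2 : ℤ)) (hs4 : W.HasSurjectiveModNGaloisRep (4 : ℤ)) (w : InfinitePlace ℚ)
    {x : galH1Torsion W (2 : ℤ)} (hx0 : x ≠ 0) (hph : ∀ ρ ∈ torsionFixing W (4 : ℤ), h1Eval W (2 : ℤ) x ρ = 0) :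
    x ∉ selmerLocalKer W w.Completion (2 : ℤ) := by
  -- numerology: level `4 = 2 ^ (1 + 1)`
  have e4 : ((2 ^ (1 + 1) : ℕ) : ℤ) = 4 := by norm_num
  have hsurj : W.HasSurjectiveModNGaloisRep ((2 ^ (1 + 1) : ℕ) : ℤ) := by rw [e4]; exact hs4
  have hn0 : (((2 ^ (1 + 1) : ℕ) : ℤ)) ≠ 0 := by norm_num
  have hN₀ : IsOpen (torsionFixing W ((2 ^ (1 + 1) : ℕ) : ℤ) : Set (absoluteGaloisGroup ℚ)) := isOpen_torsionFixing W hn0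
  have hN4 : torsionFixing W ((2 ^ (1 + 1) : ℕ) : ℤ) = torsionFixing W (4 : ℤ) := by rw [e4]
  have hmemb4 : ∀ {R : geomPoints W}, (4 : ℤ) • R = 0 → R ∈ geomTorsion W ((2 ^ (1 + 1) : ℕ) : ℤ) :=
    fun hR ↦ by rw [mem_geomTorsion_iff, e4, hR]
  -- represent `x` by a crossed homomorphism `f₂ : Γ_ℚ → E[2]` vanishing on `Γ_{ℚ(E[4])}`
  have hmem : x ∈ subgroupResKer (geomTorsion W (2 : ℤ)) (torsionFixing W ((2 ^ (1 + 1) : ℕ) : ℤ)) := by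
    have h := (oneCocycleClass_mem_subgroupResKer_iff (torsionFixing W ((2 ^ (1 + 1) : ℕ) : ℤ)) (reprCocycle W _ x)).2
      ⟨0, fun ρ ↦ by
        rw [smul_zero, sub_zero]
        have hρ4 : (ρ : absoluteGaloisGroup ℚ) ∈ torsionFixing W (4 : ℤ) := by rw [← hN4]; exact ρ.2
        exact hph ρ hρ4⟩
    rwa [oneCocycleClass_reprCocycle] at h
  have hrange := resKer_le_range_inflClass
    (Literature.NumberTheory.EllipticCurves.subgroupIncl (torsionFixing W ((2 ^ (1 + 1) : ℕ) : ℤ)))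
    (AddMonoidHom.id (geomTorsion W (2 : ℤ))) (fun _ _ ↦ rfl) Function.bijective_id
    (torsionFixing W ((2 ^ (1 + 1) : ℕ) : ℤ)) hN₀ (fun n hn ↦ ⟨⟨n, hn⟩, rfl⟩)
  obtain ⟨f₂, hfx⟩ := hrange hmem
  -- the push-out `f₄ = ι ∘ f₂ : Γ_ℚ → E[4]`, still vanishing on `Γ_{ℚ(E[4])}`
  have hmem4 : ∀ g : absoluteGaloisGroup ℚ,
      ((f₂.1 g : geomTorsion W (2 : ℤ)) : geomPoints W) ∈ geomTorsion W ((2 ^ (1 + 1) : ℕ) : ℤ) := fun g ↦ by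
    apply hmemb4
    rw [show (4 : ℤ) = 2 * 2 by norm_num, mul_zsmul, (mem_geomTorsion_iff W _ _).mp (f₂.1 g).2, zsmul_zero]
  let f₄ : cocyclesVanishingOn (geomTorsion W ((2 ^ (1 + 1) : ℕ) : ℤ)) (torsionFixing W ((2 ^ (1 + 1) : ℕ) : ℤ)) :=
    ⟨fun g ↦ ⟨((f₂.1 g : geomTorsion W (2 : ℤ)) : geomPoints W), hmem4 g⟩,
      fun g h ↦ Subtype.ext (by
        change ((f₂.1 (g * h) : geomTorsion W (2 : ℤ)) : geomPoints W) =
          ((f₂.1 g : geomTorsion W (2 : ℤ)) : geomPoints W) +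
            (((g • (⟨((f₂.1 h : geomTorsion W (2 : ℤ)) : geomPoints W), hmem4 h⟩ :
              geomTorsion W ((2 ^ (1 + 1) : ℕ) : ℤ))) : geomTorsion W ((2 ^ (1 + 1) : ℕ) : ℤ)) : geomPoints W)
        rw [cocyclesVanishingOn.cocycle f₂, AddMemClass.coe_add, AddSubgroup.torsionBy.coe_smul, AddSubgroup.torsionBy.coe_smul]),
      fun n hn ↦ Subtype.ext (by
        change ((f₂.1 n : geomTorsion W (2 : ℤ)) : geomPoints W) = ((0 : geomTorsion W ((2 ^ (1 + 1) : ℕ) : ℤ)) : geomPoints W)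
        rw [cocyclesVanishingOn.apply_of_mem f₂ hn]
        rfl)⟩
  have hf₄ : ∀ g : absoluteGaloisGroup ℚ,
      ((f₄.1 g : geomTorsion W ((2 ^ (1 + 1) : ℕ) : ℤ)) : geomPoints W) = ((f₂.1 g : geomTorsion W (2 : ℤ)) : geomPoints W) :=
    fun _ ↦ rfl
  -- the class of `f₄` is non-zero: `f₄ = ∂y` would give `2y ∈ E[2]^{Γ_ℚ} = 0`, `y ∈ E[2]`, `x = [∂y] = 0`
  have hf₄0 : inflClass (geomTorsion W ((2 ^ (1 + 1) : ℕ) : ℤ)) (torsionFixing W ((2 ^ (1 + 1) : ℕ) : ℤ)) hN₀ f₄ ≠ 0 := by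
    intro h0
    rw [inflClass_apply, oneCocycleClass_eq_zero_iff] at h0
    obtain ⟨y, hy⟩ := h0
    have hy' : ∀ g : absoluteGaloisGroup ℚ,
        ((f₂.1 g : geomTorsion W (2 : ℤ)) : geomPoints W) =
          g • ((y : geomTorsion W ((2 ^ (1 + 1) : ℕ) : ℤ)) : geomPoints W) - (y : geomPoints W) := fun g ↦ by
      have h := congrArg (fun z : geomTorsion W ((2 ^ (1 + 1) : ℕ) : ℤ) ↦ (z : geomPoints W)) (hy g)
      simp only [AddSubgroupClass.coe_sub] at h
      rw [← hf₄ g]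
      exact h
    have h2y0 : (2 : ℤ) • ((y : geomTorsion W ((2 ^ (1 + 1) : ℕ) : ℤ)) : geomPoints W) = 0 := by
      refine eq_zero_of_two_smul_eq_zero_of_forall_smul_eq W hs2 _ ?_ (fun γ ↦ ?_)
      · rw [← mul_zsmul, show (2 : ℤ) * 2 = ((2 ^ (1 + 1) : ℕ) : ℤ) by norm_num]
        exact (mem_geomTorsion_iff W _ _).mp y.2
      · rw [smul_zsmul_geomPoints, ← sub_eq_zero, ← zsmul_sub, ← hy' γ]
        exact (mem_geomTorsion_iff W _ _).mp (f₂.1 γ).2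
    apply hx0
    rw [← hfx, inflClass_apply, oneCocycleClass_eq_zero_iff]
    refine ⟨⟨((y : geomTorsion W ((2 ^ (1 + 1) : ℕ) : ℤ)) : geomPoints W), (mem_geomTorsion_iff W _ _).mpr h2y0⟩,
      fun g ↦ Subtype.ext ?_⟩
    rw [toContOneCocycle_apply, discreteTopRep_ρ_apply, AddSubgroupClass.coe_sub, AddSubgroup.torsionBy.coe_smul]
    exact hy' g
  -- the complex conjugation at `w` splits `E[4] = ℤP ⊕ ℤQ`, `cP = P`, `cQ = -Q` (archimedean inputs of g30, `Δ > 0`)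
  have hw : w.IsReal := IsTotallyReal.isReal w
  obtain ⟨σ, hσ, hall⟩ := exists_ne_one_forall_eq_of_isReal hw
  -- (`CharZero ℚ_w` is passed as a TERM, never as a local instance: a local `CharZero` instance would let `DivisionRing.toRatAlgebra`
  -- shadow the completion's own `ℚ`-algebra structure, the one the Selmer local condition is stated with)
  let e : w.Completion ≃+* ℝ := InfinitePlace.Completion.ringEquivRealOfIsReal hw
  have hfix := @smul_eq_self_of_two_smul_eq_zero W _ w.Completion _ (InfinitePlace.Completion.instAlgebra w ℚ)
    (charZero_of_injective_algebraMap (algebraMap ℚ w.Completion).injective) e hΔ σ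
  obtain ⟨R₁, hR₁4, τ, hτ⟩ := @exists_four_torsion_smul_ne W _ w.Completion _ (InfinitePlace.Completion.instAlgebra w ℚ)
    (charZero_of_injective_algebraMap (algebraMap ℚ w.Completion).injective) e hΔ
  obtain ⟨R₂, hR₂4, hR₂2, hinv⟩ := @exists_four_torsion_invariant W _ w.Completion _ (InfinitePlace.Completion.instAlgebra w ℚ)
    (charZero_of_injective_algebraMap (algebraMap ℚ w.Completion).injective) e hΔ
  have hc2 := resGal_mul_self_of_isReal (K := ℚ) hw hσ
  have hfix' : ∀ T : geomPoints W, (2 : ℤ) • T = 0 → resGal (K := ℚ) w.Completion σ • T = T := fun T hT ↦ by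
    rw [resGal_eq_absGaloisRestrict]
    exact hfix T hT
  have hne : ∃ R : geomTorsion W ((2 ^ (1 + 1) : ℕ) : ℤ), resGal (K := ℚ) w.Completion σ • R ≠ R := by
    have hτ1 : τ ≠ 1 := by
      rintro rfl
      rw [map_one, one_smul] at hτ
      exact hτ rfl
    have hτσ : τ = σ := (hall τ).resolve_left hτ1
    refine ⟨⟨R₁, hmemb4 hR₁4⟩, fun h ↦ hτ ?_⟩
    have h' := congrArg Subtype.val h
    rw [AddSubgroup.torsionBy.coe_smul, resGal_eq_absGaloisRestrict] at h'
    rw [hτσ]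
    exact h'
  have hne' : ∃ R : geomTorsion W ((2 ^ (1 + 1) : ℕ) : ℤ), resGal (K := ℚ) w.Completion σ • R ≠ -R := by
    refine ⟨⟨R₂, hmemb4 hR₂4⟩, fun h ↦ hR₂2 ?_⟩
    have h' := congrArg Subtype.val h
    rw [AddSubgroup.torsionBy.coe_smul, resGal_eq_absGaloisRestrict, AddSubgroup.coe_neg, hinv σ] at h'
    change R₂ = -R₂ at h'
    rw [two_zsmul]
    exact eq_neg_iff_add_eq_zero.mp h'
  obtain ⟨P, Q, hP, hQ, hPQ⟩ := exists_split_of_involution W 1 two_ne_zero hc2 hfix' hne hne'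
  -- were `x` a Kummer class at `w`, §1 would make `f₄` principal on `c = resGal σ`: contradiction with visibility
  intro hloc
  rw [← hfx, inflClass_apply] at hloc
  obtain ⟨R, hR4, hR⟩ :=
    @exists_fourTorsion_apply_resGal_eq_smul_sub_of_mem_selmerLocalKer W _ w.Completion _
      (InfinitePlace.Completion.instAlgebra w ℚ) (charZero_of_injective_algebraMap (algebraMap ℚ w.Completion).injective)
      e hΔ _ hloc
  refine apply_ne_smul_sub_of_split W 1 two_ne_zero hsurj hP hQ hPQ f₄ hf₄0 ⟨R, hmemb4 hR4⟩ (Subtype.ext ?_)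
  rw [AddSubgroupClass.coe_sub, AddSubgroup.torsionBy.coe_smul, hf₄]
  exact hR σ

end Main

end Summit.BirchSwinnertonDyer.BirchSwinnertonDyer.Theorems.GenusExact.Lw2PhantomExclusion.RealWitness

end
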